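import Summits.ABC.StewartYu.PadicW80Sizes3B
import Summits.ABC.StewartYu.PadicW80Budgets3
import Summits.ABC.StewartYu.DescentIntegralityThirdQ
import Summits.ABC.StewartYu.DescentSizesQ
import HarnessLib

/-!
# The `q = 3` (`p = 2`) parameter record — the archimedean sizes, III: the FRAME side, part 1 (boxes,
# height link, per-unknown factors on the triadic boxes)

Support file (theorems only; no named fact), cell `abc-stewartyu` (seat p5; crux `W80Two`
stmt-ABC-19486; route `PadicPrimesW80TwoThirds`).  Continuation of p1's record-side files
`PadicW80Sizes3{,B}.lean` on p2's TRIADIC level structure (`DescentLevelsThirdQ`: `box3`, `qΔ3`,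
`qTerm3`, `coreSum3`; `DescentThirdQ`: `qEt`; `DescentIntegralityThirdQ`: `Dclear3`), for a sign-free
datum `Q : SetupQ` at the record `P : PadicW80ParL Q.d` under the height link
`hy : Q.flat.SizeHyp P.V P.Vθ P.W` (for `S : TwoSetup` take `Q := S.toQ`).  Base-`3` twin of
`PadicW80SizesLH/LB`:
* `PadicW80ParL.Lall3_le_Uℓ`, `T3_mul_log_Γ_le` (record complements: ranges `≤ U`, `T·log(2Ue^W) ≤ 𝔘/1024`);
* (the height link itself from `h(αⱼ) ≤ Vⱼ`, … is p3's `SetupQ.flat_sizeHyp_of_logHeight` in `PadicTwoRecord`);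
* boxes: `card_box3_le_𝔔3` (`#box3_J ≤ 𝔔`), `ceil_card_box3_mul_Amax3_le_PrV3` (`⌈#box3₀·Amax⌉ ≤ PrV`),
  `two_mul_card_Pts3_tauSet_le_card_box3` (Siegel's count `2·#(Pts3 S₀ × tauSet T) ≤ #box3₀`, the `hcard`
  of `TwoSetup.siegel3_of_count`);
* per-unknown factors on `box3_J`: `abs_γ3_le`, `abs_qA3_le_𝔔3` (`|qA| ≤ 𝔔`), `expn_le_of_mem_box3_rec`,
  `prod_hgt_pow3_le`, `den_prod3_le`, `abs_qE3_le`, `abs_qEt3_le` (`≤ E(c) = exp(c𝔘/(3c_L'))` at points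
  `s ≤ 3ᴶ·c·S₀`), `natAbs_bθ_pow3_le_𝔔3`, `prod_max_one_abs_all_le` (`∏ max(1,|allᵢ|) ≤ e^{∑V+V_θ}`),
  `abs_qΔ3_le_𝔔3_pow_four` (`|qΔ3| ≤ 𝔔⁴`: p1's `abs_qΔ3_le_𝔔3` read on `SetupQ.qΔ3`).
The clearing denominators, terms, cores and third-point weights are in the sequel `PadicW80Sizes3D.lean`.
Everything is [folklore] book-keeping on [cite: Waldschmidt1980, §3.2–3.4 (pp. 266–270)] and
[cite: Yu1989, §3].

## References
* [Waldschmidt1980] M. Waldschmidt, *A lower bound for linear forms in logarithms*, Acta Arith. 37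
  (1980), Lemma 3.2 (pp. 266–267), §3.3–3.4 (3.17)–(3.22) (pp. 268–270).
* [Yu1989] K. Yu, *Linear forms in p-adic logarithms*, Acta Arith. 53 (1989), §3 (the `q`-descent).
-/

noncomputable section

open Finset Real
open Literature.NumberTheory.Transcendental
open Literature.NumberTheory.Transcendental.CW77
open Literature.NumberTheory.Transcendental.CW77.Setup (Idx Tau tauNorm tauSet)

namespace Summit.ABC.StewartYu

open PadicW80Par (cTp cSp cLp cLp' Ap mRp)
open PadicW80ParL (mR_pos two_le_mR)

/-! ### A record-side complement: the ranges are `≤ U` -/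

namespace PadicW80ParL

variable {d : ℕ} (P : PadicW80ParL d)

/-- `Lall3ᵢ ≤ U` (the denominators `c_L' m 3^{m+1} S₀ V` of the ranges are `≥ 1`). [folklore] -/
theorem Lall3_le_Uℓ (i : Fin (d + 1)) : (P.Lall3 i : ℝ) ≤ P.Uℓ := by
  have hU := P.U_pos
  have hden : ∀ V : ℝ, 1 ≤ V → 1 ≤ cLp' * mRp d * 3 ^ (d + 2) * (P.S₀3 : ℝ) * V := by
    intro V hV
    have h6 : (6 : ℝ) ≤ P.S₀3 := by exact_mod_cast P.six_le_S₀3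
    have h3 : (1 : ℝ) ≤ 3 ^ (d + 2) := one_le_pow₀ (by norm_num)
    have hm := two_le_mR P
    unfold cLp'
    calc (1 : ℝ) ≤ 2 ^ 12 * 2 * 1 * 6 * 1 := by norm_num
      _ ≤ 2 ^ 12 * mRp d * 3 ^ (d + 2) * (P.S₀3 : ℝ) * V := by gcongr
  refine Fin.lastCases ?_ (fun j => ?_) i
  · rw [P.Lall3_last]
    exact (P.Lθ3_le).trans (div_le_self hU.le (hden _ P.hVθ1))
  · rw [P.Lall3_castSucc]
    exact (P.L3_le j).trans (div_le_self hU.le (hden _ (P.hV j)))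

/-- `L3ⱼ ≤ U`. [folklore] -/
theorem L3_le_Uℓ (j : Fin d) : (P.L3 j : ℝ) ≤ P.Uℓ := by
  have := P.Lall3_le_Uℓ (Fin.castSucc j); rwa [P.Lall3_castSucc] at this

/-- `L_θ3 ≤ U`. [folklore] -/
theorem Lθ3_le_Uℓ : (P.Lθ3 : ℝ) ≤ P.Uℓ := by
  have := P.Lall3_le_Uℓ (Fin.last d); rwa [P.Lall3_last] at this

/-- `T·log(2Ue^W) ≤ 𝔘/1024` (`log(2Ue^W) ≤ 11W⋆ + 1`, `T W⋆ ≤ 𝔘/c_T`, `c_T = 2¹⁴`). [folklore] -/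
theorem T3_mul_log_Γ_le : (P.T3 : ℝ) * Real.log (2 * P.Uℓ * Real.exp P.W) ≤ P.𝔘3 / 1024 := by
  have hT := P.T3_pos; have hTW := P.T3Wstar_le; have hTU := P.T3_le_𝔘3; have hW := P.one_le_Wstar
  have hU := P.𝔘3_pos
  calc (P.T3 : ℝ) * Real.log (2 * P.Uℓ * Real.exp P.W) ≤ P.T3 * (11 * P.Wstarℓ + 1) :=
        mul_le_mul_of_nonneg_left P.log_Γ_le_p hT.le
    _ = 11 * (P.T3 * P.Wstarℓ) + P.T3 := by ring
    _ ≤ 11 * (P.𝔘3 / cTp) + P.𝔘3 / cTp := by gcongr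
    _ ≤ P.𝔘3 / 1024 := by unfold cTp; nlinarith

end PadicW80ParL

namespace SetupQ

variable (Q : SetupQ)

/-! ### The boxes of the triadic descent at the record -/

variable (P : PadicW80ParL Q.d)

/-- **`#box3_J ≤ 𝔔`** (`#box3_J = h L_b ∏ⱼ(⌊Lⱼ/3ᴶ⌋+1)(⌊L_θ/3ᴶ⌋+1)`, p1's `card_unknowns3_le_𝔔3`).
[cite: Waldschmidt1980, §3.2 (p. 266)] -/
theorem card_box3_le_𝔔3 (J : ℕ) :
    ((Q.box3 (h := P.hparℓ) (Lb := P.Lb3) P.L3 P.Lθ3 J).card : ℝ) ≤ P.𝔔3 := by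
  have key := P.card_unknowns3_le_𝔔3 J
  rw [Fin.prod_univ_castSucc] at key
  simp only [PadicW80ParL.Lall3_castSucc, PadicW80ParL.Lall3_last] at key
  rw [Q.card_box3]
  push_cast
  calc (P.hparℓ : ℝ) * P.Lb3 * ((∏ j, (((P.L3 j / 3 ^ J : ℕ) : ℝ) + 1)) * (((P.Lθ3 / 3 ^ J : ℕ) : ℝ) + 1))
      = (P.hparℓ : ℝ) * P.Lb3 * ((∏ j, (((P.L3 j / 3 ^ J : ℕ) : ℝ) + 1)) * (((P.Lθ3 / 3 ^ J : ℕ) : ℝ) + 1)) :=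
        rfl
    _ ≤ P.𝔔3 := key

/-- **`⌈#box3₀ · Amax⌉ ≤ PrV`** (`#box3₀ ≤ 𝔔`, `𝔔·Amax + 1 ≤ PrV`): the integer bound of Siegel's lemma
`siegel3_of_count` is below the record's `PrV3`. [folklore] -/
theorem ceil_card_box3_mul_Amax3_le_PrV3 :
    ((⌈((Q.box3 (h := P.hparℓ) (Lb := P.Lb3) P.L3 P.Lθ3 0).card : ℝ) * P.Amax3⌉ : ℤ) : ℝ) ≤ P.PrV3 := by
  have hcard := Q.card_box3_le_𝔔3 P 0
  have hA0 : 0 ≤ P.Amax3 := P.Amax3_pos.le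
  have h1 : ((Q.box3 (h := P.hparℓ) (Lb := P.Lb3) P.L3 P.Lθ3 0).card : ℝ) * P.Amax3 ≤ P.𝔔3 * P.Amax3 :=
    mul_le_mul_of_nonneg_right hcard hA0
  have h2 := Int.ceil_lt_add_one (((Q.box3 (h := P.hparℓ) (Lb := P.Lb3) P.L3 P.Lθ3 0).card : ℝ) * P.Amax3)
  have h3 := P.𝔔3_mul_Amax3_add_one_le
  linarith

/-- **Siegel's count at level `0`**: `2·#(Pts3 S₀ × tauSet T) ≤ #box3₀` (p1's `padic_siegel_count3`,
`#Pts3 S₀ ≤ S₀`, `#box3₀ = h L_b ∏(Lall3ᵢ + 1)`) — the hypothesis `hcard` of `TwoSetup.siegel3_of_count`.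
[cite: Waldschmidt1980, Lemma 3.2 (pp. 266–267)] -/
theorem two_mul_card_Pts3_tauSet_le_card_box3 :
    2 * (Pts3 P.S₀3 ×ˢ tauSet Q.d P.T3).card ≤ (Q.box3 (h := P.hparℓ) (Lb := P.Lb3) P.L3 P.Lθ3 0).card := by
  have hP : (Pts3 P.S₀3).card ≤ P.S₀3 := by
    unfold Pts3
    exact (card_filter_le _ _).trans (by rw [card_range])
  have key := PadicW80ParL.padic_siegel_count3 Q.flat P
  rw [Fin.prod_univ_castSucc] at key
  simp only [PadicW80ParL.Lall3_castSucc, PadicW80ParL.Lall3_last] at key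
  rw [card_product, Q.card_box3]
  simp only [pow_zero, Nat.div_one]
  calc 2 * ((Pts3 P.S₀3).card * (tauSet Q.d P.T3).card) ≤ 2 * (P.S₀3 * (tauSet Q.d P.T3).card) :=
        Nat.mul_le_mul_left _ (Nat.mul_le_mul_right _ hP)
    _ ≤ P.hparℓ * P.Lb3 * ((∏ j, (P.L3 j + 1)) * (P.Lθ3 + 1)) := key

/-! ### Exponents and height factors on the box of level `J` -/

variable {P}

/-- The exponents on the box of level `J` at a point `s ≤ 3ᴶ · c · S₀` are `≤ c Lall3ᵢ S₀`. [folklore] -/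
theorem expn_le_of_mem_box3_rec {J c : ℕ} {u : Idx Q.d P.hparℓ P.Lb3}
    (hu : u ∈ Q.box3 (h := P.hparℓ) (Lb := P.Lb3) P.L3 P.Lθ3 J) {s : ℕ} (hs : s ≤ 3 ^ J * (c * P.S₀3))
    (i : Fin (Q.d + 1)) : Q.flat.expn u s i ≤ c * P.Lall3 i * P.S₀3 := by
  rw [Q.mem_box3] at hu
  have hdiv : ∀ (lam Lq : ℕ), lam ≤ Lq / 3 ^ J → lam * s ≤ c * Lq * P.S₀3 := by
    intro lam Lq hl
    calc lam * s ≤ (Lq / 3 ^ J) * (3 ^ J * (c * P.S₀3)) := Nat.mul_le_mul hl hs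
      _ = ((Lq / 3 ^ J) * 3 ^ J) * (c * P.S₀3) := by ring
      _ ≤ Lq * (c * P.S₀3) := Nat.mul_le_mul_right _ (Nat.div_mul_le_self Lq (3 ^ J))
      _ = c * Lq * P.S₀3 := by ring
  refine Fin.lastCases ?_ (fun j => ?_) i
  · rw [Q.flat_expn_last, PadicW80ParL.Lall3_last]; exact hdiv _ _ hu.2
  · rw [Q.flat_expn_castSucc, PadicW80ParL.Lall3_castSucc]; exact hdiv _ _ (hu.1 j)

/-- `⌊L/3ᴶ⌋ · s ≤ c L S₀` for `s ≤ 3ᴶ · c · S₀`. [folklore] -/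
theorem div_pow_mul_le {L' J c s S₀ : ℕ} (hs : s ≤ 3 ^ J * (c * S₀)) : L' / 3 ^ J * s ≤ c * L' * S₀ := by
  calc L' / 3 ^ J * s ≤ (L' / 3 ^ J) * (3 ^ J * (c * S₀)) := Nat.mul_le_mul_left _ hs
    _ = ((L' / 3 ^ J) * 3 ^ J) * (c * S₀) := by ring
    _ ≤ L' * (c * S₀) := Nat.mul_le_mul_right _ (Nat.div_mul_le_self L' (3 ^ J))
    _ = c * L' * S₀ := by ring

/-- A point `s < 3^{k+1+J} S₀` is `≤ 3ᴶ · 3^{k+1} · S₀`. [folklore] -/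
theorem le_pow_mul_of_lt_step {J k s S₀ : ℕ} (hs : s < 3 ^ (k + 1 + J) * S₀) : s ≤ 3 ^ J * (3 ^ (k + 1) * S₀) := by
  rw [← Nat.mul_assoc, ← pow_add, Nat.add_comm J]; exact hs.le

/-- A point `s < 3^{J+1} S₀` is `≤ 3ᴶ · 3 · S₀`. [folklore] -/
theorem le_pow_mul_of_lt_third {J s S₀ : ℕ} (hs : s < 3 ^ (J + 1) * S₀) : s ≤ 3 ^ J * (3 * S₀) := by
  rw [← Nat.mul_assoc, ← pow_succ]; exact hs.le

end SetupQ

end Summit.ABC.StewartYu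

/-! ### The `SizeHyp` consequences on the triadic boxes (dot-notation lemmas `hy.…`) -/

namespace Literature.NumberTheory.Transcendental.CW77

namespace Setup

open Summit.ABC.StewartYu
open Summit.ABC.StewartYu.PadicW80Par (cLp' cTp cLp mRp)
open Summit.ABC.StewartYu.PadicW80ParL (mR_pos two_le_mR)

variable {Q : SetupQ} {P : PadicW80ParL Q.d} (hy : Q.flat.SizeHyp P.V P.Vθ P.W)
include hy

/-! #### Coefficients and the linear-form factor -/

/-- **`|b_θ|^k ≤ 𝔔`** for `k ≤ T` (`k W ≤ T W⋆ ≤ 𝔘/c_T`). [cite: Waldschmidt1980, §3.3 (p. 268)] -/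
theorem SizeHyp.natAbs_bθ_pow3_le_𝔔3 {k : ℕ} (hk : k ≤ P.T3) : ((Q.bθ.natAbs ^ k : ℕ) : ℝ) ≤ P.𝔔3 := by
  have h1 : ((Q.flat.bθ.natAbs ^ k : ℕ) : ℝ) ≤ Real.exp (k * P.W) := hy.natAbs_bθ_pow_le_exp k
  refine h1.trans (P.exp_le_𝔔3 ?_)
  have hTW := P.T3Wstar_le; have hW := P.W_le_Wstar; have hT := P.T3_pos; have hU := P.𝔘3_pos
  have hW1 := P.hW
  have hk' : (k : ℝ) ≤ P.T3 := by exact_mod_cast hk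
  calc (k : ℝ) * P.W ≤ P.T3 * P.Wstarℓ := mul_le_mul hk' hW (by linarith) hT.le
    _ ≤ P.𝔘3 / cTp := hTW
    _ ≤ P.𝔘3 / 1024 := by unfold cTp; rw [div_le_div_iff₀ (by norm_num) (by norm_num)]; nlinarith

/-- `|γⱼ(u)| ≤ 2 U e^W` on the box of level `J` of the triadic descent. [cite: Waldschmidt1980, §3.3 (p. 268)] -/
theorem SizeHyp.abs_γ3_le {J : ℕ} {u : Idx Q.d P.hparℓ P.Lb3}
    (hu : u ∈ Q.box3 (h := P.hparℓ) (Lb := P.Lb3) P.L3 P.Lθ3 J) (j : Fin Q.d) :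
    |(Q.flat.γ u j : ℝ)| ≤ 2 * P.Uℓ * Real.exp P.W := by
  rw [Q.mem_box3] at hu
  unfold γ
  push_cast
  have h1 : (u.2.1 j : ℝ) ≤ P.Uℓ := by
    have : (u.2.1 j : ℝ) ≤ P.L3 j := by exact_mod_cast (hu.1 j).trans (Nat.div_le_self _ _)
    exact this.trans (P.L3_le_Uℓ j)
  have h2 : (u.2.2 : ℝ) ≤ P.Uℓ := by
    have : (u.2.2 : ℝ) ≤ P.Lθ3 := by exact_mod_cast hu.2.trans (Nat.div_le_self _ _)
    exact this.trans P.Lθ3_le_Uℓ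
  have hW : 1 ≤ Real.exp P.W := Real.one_le_exp (by linarith [P.hW])
  have hU := P.U_pos
  calc |(u.2.1 j : ℝ) + (u.2.2 : ℝ) * (Q.flat.β j : ℝ)| ≤ |(u.2.1 j : ℝ)| + |(u.2.2 : ℝ) * (Q.flat.β j : ℝ)| :=
        abs_add_le _ _
    _ = (u.2.1 j : ℝ) + (u.2.2 : ℝ) * |(Q.flat.β j : ℝ)| := by
        rw [abs_mul, Nat.abs_cast, Nat.abs_cast]
    _ ≤ P.Uℓ + P.Uℓ * Real.exp P.W := add_le_add h1 (mul_le_mul h2 (hy.abs_β_le j) (abs_nonneg _) hU.le)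
    _ ≤ 2 * P.Uℓ * Real.exp P.W := by nlinarith

/-- **`|qA(u, τ')| ≤ 𝔔`** on the box of level `J` of the triadic descent, `|τ'| ≤ T`
(`T·log(2Ue^W) ≤ 12𝔘/c_T ≤ 𝔘/1024`). [cite: Waldschmidt1980, §3.3 (proof of Lemma 3.3, p. 268)] -/
theorem SizeHyp.abs_qA3_le_𝔔3 {J : ℕ} {u : Idx Q.d P.hparℓ P.Lb3}
    (hu : u ∈ Q.box3 (h := P.hparℓ) (Lb := P.Lb3) P.L3 P.Lθ3 J)
    {τ' : Fin Q.d → ℕ} (hτ : ∑ j, τ' j ≤ P.T3) : |(Q.flat.qA u τ' : ℝ)| ≤ P.𝔔3 := by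
  set Γ := 2 * P.Uℓ * Real.exp P.W with hΓ
  have hΓ1 : 1 ≤ Γ := P.one_le_Γ_p
  have h1 : |(Q.flat.qA u τ' : ℝ)| ≤ Γ ^ P.T3 := by
    unfold qA; push_cast
    rw [abs_prod]
    calc ∏ j, |(Q.flat.γ u j : ℝ) ^ τ' j| = ∏ j, |(Q.flat.γ u j : ℝ)| ^ τ' j :=
          prod_congr rfl fun j _ => abs_pow _ _
      _ ≤ ∏ j, Γ ^ τ' j := prod_le_prod (fun j _ => by positivity)
          fun j _ => pow_le_pow_left₀ (abs_nonneg _) (hy.abs_γ3_le hu j) _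
      _ = Γ ^ ∑ j, τ' j := (prod_pow_eq_pow_sum _ _ _)
      _ ≤ Γ ^ P.T3 := pow_le_pow_right₀ hΓ1 hτ
  refine h1.trans (P.le_𝔔3_of_log_le ?_)
  rw [Real.log_pow]
  exact P.T3_mul_log_Γ_le

/-! #### Height factors -/

/-- **`∏ H(all♭ᵢ)^{eᵢ} ≤ E(c) = exp(c 𝔘/(3c_L'))`** when `eᵢ ≤ c Lall3ᵢ S₀` (p1's `sum_eV3_le`).
[cite: Waldschmidt1980, (3.11) (p. 265)] -/
theorem SizeHyp.prod_hgt_pow3_le {e : Fin (Q.d + 1) → ℕ} {c : ℕ} (he : ∀ i, e i ≤ c * P.Lall3 i * P.S₀3) :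
    ∏ i, hgt (Q.flat.all i) ^ e i ≤ P.Efac3 c := by
  calc ∏ i, hgt (Q.flat.all i) ^ e i ≤ ∏ i, Real.exp (e i * P.Vallℓ i) :=
        prod_le_prod (fun i _ => pow_nonneg (hgt_pos _).le _) fun i _ => hy.hgt_pow_le i (e i)
    _ = Real.exp (∑ i, (e i : ℝ) * P.Vallℓ i) := (Real.exp_sum _ _).symm
    _ ≤ P.Efac3 c := Real.exp_le_exp.mpr (P.sum_eV3_le he)

/-- **The denominators `∏ den(αⱼ)^{eⱼ} · den θ^{e_θ} ≤ E(c)`** of the SIGNED generators when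
`eⱼ ≤ c L3ⱼ S₀`, `e_θ ≤ c L_θ3 S₀` (`den |q| = den q ≤ H(q)`). [cite: Waldschmidt1980, (3.11) (p. 265)] -/
theorem SizeHyp.den_prod3_le {e : Fin Q.d → ℕ} {eθ : ℕ} {c : ℕ} (he : ∀ j, e j ≤ c * P.L3 j * P.S₀3)
    (heθ : eθ ≤ c * P.Lθ3 * P.S₀3) :
    (((∏ j, (Q.α j).den ^ e j) * Q.θ.den ^ eθ : ℕ) : ℝ) ≤ P.Efac3 c := by
  set e' : Fin (Q.d + 1) → ℕ := Fin.snoc e eθ with he'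
  have hall : (((∏ j, (Q.α j).den ^ e j) * Q.θ.den ^ eθ : ℕ) : ℝ) = ∏ i, ((Q.all i).den : ℝ) ^ e' i := by
    push_cast
    rw [Fin.prod_univ_castSucc]
    unfold SetupQ.all
    simp only [he', Fin.snoc_castSucc, Fin.snoc_last]
  rw [hall]
  have he'' : ∀ i, e' i ≤ c * P.Lall3 i * P.S₀3 := by
    intro i
    refine Fin.lastCases ?_ (fun j => ?_) i
    · simp only [he', Fin.snoc_last, PadicW80ParL.Lall3_last]; exact heθ
    · simp only [he', Fin.snoc_castSucc, PadicW80ParL.Lall3_castSucc]; exact he j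
  refine le_trans ?_ (hy.prod_hgt_pow3_le he'')
  refine prod_le_prod (fun i _ => by positivity) fun i _ => ?_
  refine pow_le_pow_left₀ (by positivity) ?_ _
  rw [Q.flat_all, ← Rat.den_abs_eq_den (Q.all i)]
  exact den_le_hgt _

/-- **`|qE(u, s)| ≤ E(c)`** (signed core) on the box of level `J`, `s ≤ 3ᴶ c S₀`.
[cite: Waldschmidt1980, §3.4 (3.21) (p. 269)] -/
theorem SizeHyp.abs_qE3_le {J c : ℕ} {u : Idx Q.d P.hparℓ P.Lb3}
    (hu : u ∈ Q.box3 (h := P.hparℓ) (Lb := P.Lb3) P.L3 P.Lθ3 J)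
    {s : ℕ} (hs : s ≤ 3 ^ J * (c * P.S₀3)) : |(Q.qE u s : ℝ)| ≤ P.Efac3 c := by
  have he := Q.expn_le_of_mem_box3_rec hu hs
  rw [Q.qE_eq_prod_all]
  push_cast
  rw [abs_prod]
  refine le_trans ?_ (hy.prod_hgt_pow3_le he)
  refine prod_le_prod (fun i _ => abs_nonneg _) fun i _ => ?_
  rw [abs_pow]
  refine pow_le_pow_left₀ (abs_nonneg _) ?_ _
  rw [Q.flat_all, SetupQ.hgt_abs]
  exact abs_le_hgt _

/-- **`|qEt(u, s)| ≤ E(c)`** (the rational part of the third-point value, exponents `⌊expnᵢ/3⌋ ≤ expnᵢ`)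
on the box of level `J`, `s ≤ 3ᴶ c S₀`. [cite: Yu1989, §3] [cite: Waldschmidt1980, §3.4 (3.22) (p. 270)] -/
theorem SizeHyp.abs_qEt3_le {J c : ℕ} {u : Idx Q.d P.hparℓ P.Lb3}
    (hu : u ∈ Q.box3 (h := P.hparℓ) (Lb := P.Lb3) P.L3 P.Lθ3 J)
    {s : ℕ} (hs : s ≤ 3 ^ J * (c * P.S₀3)) : |(Q.qEt u s : ℝ)| ≤ P.Efac3 c := by
  have he := Q.expn_le_of_mem_box3_rec hu hs
  rw [← Rat.cast_abs, Q.abs_qEt]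
  push_cast
  have he'' : ∀ i, Q.flat.expn u s i / 3 ≤ c * P.Lall3 i * P.S₀3 := fun i => (Nat.div_le_self _ _).trans (he i)
  refine le_trans ?_ (hy.prod_hgt_pow3_le he'')
  refine prod_le_prod (fun i _ => pow_nonneg (by exact_mod_cast (Q.flat.all_pos i).le) _) fun i _ => ?_
  exact pow_le_pow_left₀ (by exact_mod_cast (Q.flat.all_pos i).le) (self_le_hgt _) _

/-- **`∏ᵢ max(1, |allᵢ|) ≤ exp(∑ Vⱼ + V_θ)`** (`max(1,|q|) ≤ H(q)`): the height factor of the multicubic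
Liouville threshold of `thirdStep_of_numerics`. [cite: Waldschmidt1980, §3.1 (3.1) (p. 263)] -/
theorem SizeHyp.prod_max_one_abs_all_le :
    ∏ i, max 1 |(Q.all i : ℝ)| ≤ Real.exp ((∑ j, P.V j) + P.Vθ) := by
  have h1 : ∀ i, max 1 |(Q.all i : ℝ)| ≤ hgt (Q.flat.all i) := by
    intro i
    rw [Q.flat_all, SetupQ.hgt_abs]
    exact max_le (one_le_hgt _) (abs_le_hgt _)
  have h2 := hy.heightProd_le
  have hs : ∑ i, (Fin.snoc P.V P.Vθ : Fin (Q.d + 1) → ℝ) i = (∑ j, P.V j) + P.Vθ := by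
    rw [Fin.sum_univ_castSucc]; simp only [Fin.snoc_castSucc, Fin.snoc_last]
  unfold heightProd at h2
  rw [hs] at h2
  calc ∏ i, max 1 |(Q.all i : ℝ)| ≤ ∏ i, hgt (Q.flat.all i) :=
        prod_le_prod (fun i _ => by positivity) fun i _ => h1 i
    _ ≤ Real.exp ((∑ j, P.V j) + P.Vθ) := h2

omit hy in
/-- `1 ≤ ∏ᵢ max(1, |allᵢ|)`. [folklore] -/
theorem one_le_prod_max_one_abs_all (Q : SetupQ) : (1 : ℝ) ≤ ∏ i, max 1 |(Q.all i : ℝ)| :=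
  Finset.one_le_prod fun _ _ => le_max_left _ _

/-! #### The `Δ`-factor -/

omit hy in
/-- **`|qΔ3_{J₀,J}(u; τ₀, s)| ≤ 𝔔⁴`** at the record (`J₀ = J₀3`, `J ≤ J₀`, `τ₀ ≤ T`, `s ≤ 3^{d+1+J} S₀`):
p1's `abs_qΔ3_le_𝔔3` read on p2's `SetupQ.qΔ3 = DwQ (3^{J₀−J}) r l h τ₀ s`.
[cite: Waldschmidt1980, §3.4 (3.17) (p. 266)] -/
theorem abs_qΔ3_le_𝔔3_pow_four (Q : SetupQ) (P : PadicW80ParL Q.d) {J : ℕ} (hJ : J ≤ P.J₀3)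
    (u : Idx Q.d P.hparℓ P.Lb3) {τ₀ s : ℕ} (hτ : τ₀ ≤ P.T3) (hs : s ≤ 3 ^ (Q.d + 1 + J) * P.S₀3) :
    |(Q.qΔ3 P.J₀3 J u τ₀ s : ℝ)| ≤ P.𝔔3 ^ 4 := by
  unfold SetupQ.qΔ3
  exact P.abs_qΔ3_le_𝔔3 u.1.1.isLt u.1.2.isLt hτ hJ hs

end Setup

end Literature.NumberTheory.Transcendental.CW77

end
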